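import Literature.MathematicalPhysics.QuantumFieldTheory.WilsonFinTorusSliceKernel
import Literature.MathematicalPhysics.QuantumLattice.LatticeScalarField
import Mathlib.Topology.Algebra.InfiniteSum.Basic
import Mathlib.Data.ZMod.Basic
import Mathlib.Analysis.InnerProductSpace.PiL2
import HarnessLib

/-!
# ENGINE-KL layer (K5, window bookkeeping) for `SqueezedSkewness.TorusKL` (stmt-QuantumFields-23204, stub `stub_torusMixtureData`):
# CENTRED TORUS COORDINATES AND THE SUPPORT WINDOW OF A TEST FUNCTION

The stub indexes lattice points by `x : Fin 4 → ℤ` (embedded as `s • siteToE x`) and torus sites by `Fin S × Fin S × Fin S × Fin T` with the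
CENTRED coordinate `cc n i = i` (`2i < n`) resp. `i − n` (`2i ≥ n`).  This file (no gauge theory) proves: the reindexing
`Σ_{x : torus} F x = Σ_t Σ_q F (q.toSite t)` (`sum_finTorusSite_eq_sum_toSite`); `((cc S j : ℤ) : ZMod S) = ZMod.finEquiv S j`; injectivity
and range of `cc`, hence injectivity and range of the site map `(t, q) ↦ (cc T t, cc S q)` (`window_injective`, `window_range`); the reduction of
a `tsum` over `ℤ⁴` supported in that range to a finite sum (`tsum_eq_sum_of_support`); and the WINDOW LEMMA `window_of_ne_zero`: if
`f (s • x) ≠ 0` for `f` supported in `{0 < y₀ ≤ H} ∩ {|y_k| < s (L + ½)}` with `2H + 3s ≤ sT`, then `1 ≤ x₀ ≤ H/s`, `2x₀ + 3 ≤ T` and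
`|x_k| ≤ L`.  Seat `ym-line-fcl-p3` g16; theorems only; nothing about a summit, NT or the mass gap.  [folklore]
-/

set_option autoImplicit false

noncomputable section

open Function
open Literature.MathematicalPhysics.QuantumFieldTheory Literature.MathematicalPhysics.QuantumLattice

namespace Summit.QuantumFields.YangMills.Theorems.TorusKL.Window

/-! ## §1 Torus sites versus (time, spatial site) -/

/-- `Σ_{x : torus} F x = Σ_t Σ_q F (q.toSite t)`. [folklore] -/
theorem sum_finTorusSite_eq_sum_toSite {S T : ℕ} {M : Type*} [AddCommMonoid M] (F : FinTorusSite S S S T → M) :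
    ∑ x, F x = ∑ t : Fin T, ∑ q : FinSpatialSite S S S, F (q.toSite t) := by
  rw [← Fintype.sum_prod_type' (f := fun (t : Fin T) (q : FinSpatialSite S S S) => F (q.toSite t))]
  exact (Fintype.sum_equiv ⟨fun p : Fin T × FinSpatialSite S S S => p.2.toSite p.1, fun x => (x.2.2.2, (x.1, x.2.1, x.2.2.1)),
    fun ⟨_, _, _, _⟩ => rfl, fun ⟨_, _, _, _⟩ => rfl⟩ (fun p => F (p.2.toSite p.1)) F (fun _ => rfl)).symm

/-! ## §2 The centred coordinate `cc n i = if 2 i < n then i else i − n` -/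

/-- The centred coordinate of `j : Fin S`, cast to `ZMod S`, is `j`. [folklore] -/
theorem intCast_centered_eq_finEquiv (S : ℕ) [NeZero S] (j : Fin S) :
    (((if 2 * j.val < S then (j.val : ℤ) else (j.val : ℤ) - S : ℤ)) : ZMod S) = ZMod.finEquiv S j := by
  have h1 : (((if 2 * j.val < S then (j.val : ℤ) else (j.val : ℤ) - S : ℤ)) : ZMod S) = ((j.val : ℕ) : ZMod S) := by
    split_ifs <;> simp
  rw [h1]
  apply ZMod.val_injective
  rw [ZMod.val_natCast, Nat.mod_eq_of_lt j.isLt]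
  obtain ⟨n, hn⟩ : ∃ n, S = n + 1 := ⟨S - 1, (Nat.succ_pred_eq_of_pos (Nat.pos_of_ne_zero (NeZero.ne S))).symm⟩
  subst hn
  rfl

/-- The centred coordinate is injective. [folklore] -/
theorem centered_injective (n : ℕ) :
    Injective fun i : Fin n => (if 2 * i.val < n then (i.val : ℤ) else (i.val : ℤ) - n : ℤ) := by
  intro i j h
  simp only at h
  ext
  split_ifs at h <;> omega

/-- Every integer of the centred window `[−⌊n/2⌋, ⌈n/2⌉)` is a centred coordinate. [folklore] -/
theorem exists_centered_eq (n : ℕ) (z : ℤ) (h1 : -((n / 2 : ℕ) : ℤ) ≤ z) (h2 : 2 * z < n) :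
    ∃ i : Fin n, (if 2 * i.val < n then (i.val : ℤ) else (i.val : ℤ) - n : ℤ) = z := by
  by_cases hz : 0 ≤ z
  · have e1 : ((z.toNat : ℕ) : ℤ) = z := Int.toNat_of_nonneg hz
    refine ⟨⟨z.toNat, by omega⟩, ?_⟩
    simp only
    rw [if_pos (by omega)]; omega
  · have e1 : (((z + n).toNat : ℕ) : ℤ) = z + n := Int.toNat_of_nonneg (by omega)
    refine ⟨⟨(z + n).toNat, by omega⟩, ?_⟩
    simp only
    rw [if_neg (by omega)]; omega

/-! ## §3 The site map `(t, q) ↦ (cc T t, cc S q₁, cc S q₂, cc S q₃) ∈ ℤ⁴` -/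

/-- The site map is injective. [folklore] -/
theorem window_injective {S T : ℕ} (cc : (n : ℕ) → Fin n → ℤ)
    (hcc : cc = fun (n : ℕ) (i : Fin n) => if 2 * i.val < n then (i.val : ℤ) else (i.val : ℤ) - n) :
    Injective fun p : Fin T × FinSpatialSite S S S => (![cc T p.1, cc S p.2.1, cc S p.2.2.1, cc S p.2.2.2] : Fin 4 → ℤ) := by
  rintro ⟨t, a, b, c⟩ ⟨t', a', b', c'⟩ h
  have h0 : cc T t = cc T t' := by simpa using congrFun h 0
  have h1 : cc S a = cc S a' := by simpa using congrFun h 1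
  have h2 : cc S b = cc S b' := by simpa using congrFun h 2
  have h3 : cc S c = cc S c' := by simpa using congrFun h 3
  subst hcc
  simp only [Prod.mk.injEq]
  exact ⟨centered_injective T h0, centered_injective S h1, centered_injective S h2, centered_injective S h3⟩

/-- A point of `ℤ⁴` whose coordinates lie in the centred windows is in the range of the site map. [folklore] -/
theorem window_range {S T : ℕ} (cc : (n : ℕ) → Fin n → ℤ)
    (hcc : cc = fun (n : ℕ) (i : Fin n) => if 2 * i.val < n then (i.val : ℤ) else (i.val : ℤ) - n) (x : Fin 4 → ℤ)
    (h0 : -((T / 2 : ℕ) : ℤ) ≤ x 0) (h0' : 2 * x 0 < T) (hk : ∀ k : Fin 3, -((S / 2 : ℕ) : ℤ) ≤ x k.succ ∧ 2 * x k.succ < S) :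
    x ∈ Set.range fun p : Fin T × FinSpatialSite S S S => (![cc T p.1, cc S p.2.1, cc S p.2.2.1, cc S p.2.2.2] : Fin 4 → ℤ) := by
  subst hcc
  obtain ⟨t, ht⟩ := exists_centered_eq T (x 0) h0 h0'
  obtain ⟨a, ha⟩ := exists_centered_eq S (x 1) (hk 0).1 (hk 0).2
  obtain ⟨b, hb⟩ := exists_centered_eq S (x 2) (hk 1).1 (hk 1).2
  obtain ⟨c, hc⟩ := exists_centered_eq S (x 3) (hk 2).1 (hk 2).2
  refine ⟨(t, (a, b, c)), funext fun i => ?_⟩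
  fin_cases i
  · simpa using ht
  · simpa using ha
  · simpa using hb
  · simpa using hc

/-- A `tsum` over `ℤ⁴` (or any type) of a function vanishing off the range of an injective map from a finite type is the finite sum over
that type. [folklore] -/
theorem tsum_eq_sum_of_support {ι α M : Type*} [Fintype ι] [AddCommMonoid M] [TopologicalSpace M] (Φ : ι → α) (hΦ : Injective Φ)
    (φ : α → M) (h0 : ∀ x, x ∉ Set.range Φ → φ x = 0) : ∑' x, φ x = ∑ p, φ (Φ p) := by
  rw [← hΦ.tsum_eq (f := φ) (fun x hx => by by_contra h; exact hx (h0 x h)), tsum_fintype]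

/-! ## §4 The support window of the test function -/

/-- **Window lemma.**  If `f (s • x) ≠ 0` for `f` supported in `{0 < y₀ ≤ H} ∩ {|y_k| < s (L + ½)}` and `2H + 3s ≤ sT`, then
`1 ≤ x₀`, `x₀ ≤ H/s`, `2x₀ + 3 ≤ T` and `−L ≤ x_k ≤ L`. [folklore] -/
theorem window_of_ne_zero {L T : ℕ} {s H : ℝ} (hs : 0 < s) (hHT : 2 * H + 3 * s ≤ s * T) {f : EuclideanSpace ℝ (Fin 4) → ℝ}
    (hf1 : tsupport f ⊆ {y | 0 < y 0 ∧ y 0 ≤ H}) (hf2 : tsupport f ⊆ {y | ∀ i : Fin 3, |y i.succ| < s * (L + 1 / 2)})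
    (x : Fin 4 → ℤ) (hx : f (s • siteToE (d := 4) x) ≠ 0) :
    1 ≤ x 0 ∧ (x 0 : ℝ) ≤ H / s ∧ 2 * x 0 + 3 ≤ (T : ℤ) ∧ ∀ k : Fin 3, -(L : ℤ) ≤ x k.succ ∧ x k.succ ≤ L := by
  have hmem : s • siteToE (d := 4) x ∈ tsupport f := subset_tsupport _ (Function.mem_support.2 hx)
  have h1 := hf1 hmem
  have h2 := hf2 hmem
  simp only [Set.mem_setOf_eq, PiLp.smul_apply, siteToE_apply, smul_eq_mul] at h1 h2
  have hx0 : (0 : ℝ) < x 0 := (mul_pos_iff_of_pos_left hs).1 h1.1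
  have hx0' : (1 : ℤ) ≤ x 0 := by exact_mod_cast (show (0 : ℤ) < x 0 by exact_mod_cast hx0)
  have hxH : (x 0 : ℝ) ≤ H / s := by rw [le_div_iff₀ hs, mul_comm]; exact h1.2
  have hT : (2 * x 0 + 3 : ℝ) ≤ T := by
    have : s * (2 * x 0 + 3) ≤ s * T := by nlinarith [h1.2]
    exact le_of_mul_le_mul_left this hs
  refine ⟨hx0', hxH, by exact_mod_cast hT, fun k => ?_⟩
  have hk := h2 k
  rw [abs_mul, abs_of_pos hs] at hk
  replace hk := abs_lt.1 (lt_of_mul_lt_mul_left hk hs.le)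
  have hlo : (-(L : ℝ) - 1) < x k.succ := by linarith [hk.1]
  have hhi : (x k.succ : ℝ) < L + 1 := by linarith [hk.2]
  have hlo' : -(L : ℤ) - 1 < x k.succ := by exact_mod_cast hlo
  have hhi' : x k.succ < (L : ℤ) + 1 := by exact_mod_cast hhi
  constructor <;> omega

end Summit.QuantumFields.YangMills.Theorems.TorusKL.Window

end
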